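import Summits.ValiantsHypothesis.ValiantsHypothesis.Theorems.BarrierLeverChowBenchmarkPairsWindowCertDefs

/-!
# Route BarrierLever — item 22038 `ChowBenchmarkPairs`, line `moore_peel`, stub `stub_window`:
# kernel certificates for `det (peelMatrix i) ≠ 0`, part 2 — the BLOCK-TRIANGULAR layer and its soundness

Helper file (`--supports stmt-ValiantsHypothesis-22038`; cell val-lit, seat val-lit-p5 g9; rung V4, 𝒟-side benchmark
of record, registered line `Cruxes/ChowBenchmarkPairs/Lines/moore_peel.lean`, stub `stub_window`).  Closes NO item.

The factorial zeta matrices `G_i[j, m] = |T_{c_i+m} ∖ T_j|! · [T_j ⊆ T_{c_i+m}]` are sparse, and after a row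
permutation `σ` and a column permutation `τ` they are BLOCK UPPER TRIANGULAR with small diagonal blocks (the
Dulmage–Mendelsohn decomposition: largest block 61 × 61 at `i = 117`, most blocks 1 × 1).  A certificate for `G_i` is
therefore `(σ, τ, sizes)` (≈ 1.2 KB): the kernel recomputes the permuted rows (`permRows`), checks that every row of
each diagonal block vanishes left of the block and that the diagonal block passes the inverse check modulo `p`
(`checkBlocks`, using part 1's `certOK`), and that `σ`, `τ` are permutations (`permCheck`).  Soundness:

* **`det_ne_zero_of_checkBlocks`** — induction along the blocks through `Matrix.fromBlocks` /
  `Matrix.det_fromBlocks_zero₂₁` (the lower-left block vanishes by **`prefix_zero_of_checkBlocks`**);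
* **`det_peelMatrix_ne_zero_of_btfCert`** — the permuted matrix is `(peelMatrix i).submatrix σ τ` for two
  equivalences of `Fin i`, whose determinant has the same absolute value (`Matrix.abs_det_submatrix_equiv_equiv`);
* **`det_peelMatrix_ne_zero_of_btfTableCheck`** — a table `(i, σ, τ, sizes)` covering a range certifies the range.

Also restated here (by-name stub credit recipe of planner natproofs-p1 g19, as for p569457 / p580598): `Stmt.stub_window`.

WHAT THIS IS NOT: nothing on the ∀h stub `stub_segmentMeanValue`, on items 19717 / 14610, or on `VP` versus `VNP`.
-/

set_option linter.dupNamespace false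
set_option autoImplicit false

namespace Summit.ValiantsHypothesis.ValiantsHypothesis.Theorems.BarrierLever.MoorePeel

open Finset

/-! ## 1. Block-triangular certificates: permutations + diagonal blocks -/

/-- `L` lists a permutation of `0, …, i-1`. -/
def permCheck (i : ℕ) (L : List ℕ) : Bool :=
  decide (L.length = i) && L.all (· < i) && decide L.Nodup

/-- The rows of the permuted matrix `N[a, b] = G_i[σ a, τ b]` (natural entries, recomputed). -/
def permRows (i : ℕ) (σ τ : List ℕ) : List (List ℕ) := σ.map fun j => τ.map fun m => gEntry i j m

/-- Walk the rows block by block (`sizes` = diagonal block sizes, `off` = first column of the current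
block): every row of the current block vanishes left of the block, the diagonal block passes the inverse
check modulo `p`, and all rows are consumed. -/
def checkBlocks (p : ℕ) : List (List ℕ) → ℕ → List ℕ → Bool
  | rows, _, [] => rows.isEmpty
  | rows, off, s :: ss =>
    ((rows.take s).all fun r => (r.take off).all fun x => x == 0) &&
      certOK p s ((rows.take s).map fun r => (r.drop off).take s) &&
        checkBlocks p (rows.drop s) (off + s) ss

/-- **The block-triangular certificate for `G_i`**: `d = (σ, τ, sizes)`, row / column permutations and the
sizes of the diagonal blocks of the permuted matrix, which must be block upper triangular with every diagonal
block invertible modulo `p`. -/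
def btfCert (p i : ℕ) (d : List ℕ × List ℕ × List ℕ) : Bool :=
  permCheck i d.1 && permCheck i d.2.1 && decide (d.2.2.sum = i) &&
    checkBlocks p (permRows i d.1 d.2.1) 0 d.2.2

/-- A table of certificates `(i, σ, τ, sizes)` covering exactly `a ≤ i < a + len`. -/
def btfTableCheck (p a len : ℕ) (T : List (ℕ × List ℕ × List ℕ × List ℕ)) : Bool :=
  decide (T.map Prod.fst = List.range' a len) && T.all fun e => btfCert p e.1 e.2

/-! ## 2. Soundness -/

/-- Reading inside a `take`. -/
theorem getD_take_of_lt {α : Type*} (l : List α) (d : α) {n b : ℕ} (h : b < n) :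
    (l.take n).getD b d = l.getD b d := by
  simp [List.getD_eq_getElem?_getD, h]

/-- Entry `(a, b)` of the extracted diagonal block = entry `(a, off + b)` of the rows. -/
theorem blockRows_getD (rows : List (List ℕ)) (s off a b : ℕ) (ha : a < (rows.take s).length) (hb : b < s) :
    ((((rows.take s).map fun r => (r.drop off).take s)).getD a []).getD b 0 =
      (rows.getD a []).getD (off + b) 0 := by
  have has : a < s := by simp at ha; omega
  rw [List.getD_eq_getElem ((rows.take s).map fun r => (r.drop off).take s) [] (by simpa using ha)]
  simp only [List.getElem_map]
  have hdrop : ∀ (l : List ℕ) (n b : ℕ), (l.drop n).getD b 0 = l.getD (n + b) 0 := fun l n b => by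
    simp [List.getD_eq_getElem?_getD, List.getElem?_drop]
  rw [getD_take_of_lt _ _ hb, hdrop, ← List.getD_eq_getElem (rows.take s) [] ha,
    getD_take_of_lt _ _ has]

/-- Entry `(a, c)` of `permRows i σ τ` is `gEntry i σ_a τ_c`. -/
theorem permRows_getD (i : ℕ) (σ τ : List ℕ) (a c : ℕ) (ha : a < σ.length) (hc : c < τ.length) :
    ((permRows i σ τ).getD a []).getD c 0 = gEntry i (σ.getD a 0) (τ.getD c 0) := by
  unfold permRows
  rw [List.getD_eq_getElem (σ.map fun j => τ.map fun m => gEntry i j m) [] (by simpa using ha)]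
  simp only [List.getElem_map]
  rw [List.getD_eq_getElem (τ.map fun m => gEntry i σ[a] m) 0 (by simpa using hc)]
  simp only [List.getElem_map]
  rw [List.getD_eq_getElem σ 0 ha, List.getD_eq_getElem τ 0 hc]

/-- Rows that pass `checkBlocks … off …` vanish in every column `< off`. -/
theorem prefix_zero_of_checkBlocks (p : ℕ) :
    ∀ (ss : List ℕ) (rows : List (List ℕ)) (off : ℕ), checkBlocks p rows off ss = true →
      ∀ r ∈ rows, ∀ b < off, r.getD b 0 = 0
  | [], rows, off, h, r, hr, b, hb => by
      rw [checkBlocks, List.isEmpty_iff] at h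
      subst h
      simp at hr
  | s :: ss, rows, off, h, r, hr, b, hb => by
      rw [checkBlocks, Bool.and_eq_true, Bool.and_eq_true] at h
      obtain ⟨⟨hz, -⟩, hrec⟩ := h
      rw [← List.take_append_drop s rows, List.mem_append] at hr
      rcases hr with hr | hr
      · have hall := List.all_eq_true.mp (List.all_eq_true.mp hz r hr)
        by_cases hbl : b < r.length
        · have hmem : r.getD b 0 ∈ r.take off := by
            rw [List.getD_eq_getElem _ _ hbl]
            exact List.mem_take_iff_getElem.mpr ⟨b, by simp [hb, hbl], rfl⟩
          simpa using hall _ hmem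
        · exact List.getD_eq_default _ _ (Nat.le_of_not_lt hbl)
      · exact prefix_zero_of_checkBlocks p ss (rows.drop s) (off + s) hrec r hr b (by omega)

/-- **Main induction**: a passing `checkBlocks` makes the trailing principal submatrix nonsingular. -/
theorem det_ne_zero_of_checkBlocks {p : ℕ} (hp : 1 < p) (N : ℕ → ℕ → ℕ) (W : ℕ) :
    ∀ (ss : List ℕ) (rows : List (List ℕ)) (off n : ℕ), ss.sum = n → off + n = W → rows.length = n →
      (∀ a < n, ∀ c < W, (rows.getD a []).getD c 0 = N (off + a) c) →
      checkBlocks p rows off ss = true →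
      (Matrix.of fun a b : Fin n => ((N (off + a) (off + b) : ℕ) : ℤ)).det ≠ 0
  | [], rows, off, n, hn, _, _, _, _ => by
      simp only [List.sum_nil] at hn
      subst hn
      rw [Matrix.det_isEmpty]
      exact one_ne_zero
  | s :: ss, rows, off, n, hn, hW, hlen, hR, h => by
      simp only [List.sum_cons] at hn
      subst hn
      rw [checkBlocks, Bool.and_eq_true, Bool.and_eq_true] at h
      obtain ⟨⟨-, hcert⟩, hrec⟩ := h
      have hlt : (rows.take s).length = s := by simp [hlen]
      have hld : (rows.drop s).length = ss.sum := by simp [hlen]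
      have hdrop : ∀ (l : List (List ℕ)) (n b : ℕ), (l.drop n).getD b [] = l.getD (n + b) [] :=
        fun l n b => by simp [List.getD_eq_getElem?_getD, List.getElem?_drop]
      -- the diagonal block
      set A : Matrix (Fin s) (Fin s) ℤ := Matrix.of fun a b : Fin s => ((N (off + a) (off + b) : ℕ) : ℤ) with hAdef
      have hA : A.det ≠ 0 := by
        refine det_ne_zero_of_mulCheck hp A _ _ (fun r hr => ?_) (fun a b => ?_) hcert
        · obtain ⟨r', -, rfl⟩ := List.mem_map.mp hr
          exact List.length_take_le _ _
        · have ha : (a : ℕ) < (rows.take s).length := by rw [hlt]; exact a.2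
          rw [hAdef, Matrix.of_apply, blockRows_getD rows s off a b ha b.2, hR a (by omega) (off + b) (by omega)]
      -- the trailing block
      have hD : (Matrix.of fun a b : Fin ss.sum =>
          ((N (off + s + a) (off + s + b) : ℕ) : ℤ)).det ≠ 0 :=
        det_ne_zero_of_checkBlocks hp N W ss (rows.drop s) (off + s) ss.sum rfl (by omega) hld
          (fun a ha c hc => by rw [hdrop, hR (s + a) (by omega) c hc, Nat.add_assoc]) hrec
      -- the lower-left block vanishes
      have hC : ∀ (a : Fin ss.sum) (b : Fin s), N (off + (s + a)) (off + b) = 0 := by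
        intro a b
        have hz := prefix_zero_of_checkBlocks p ss (rows.drop s) (off + s) hrec ((rows.drop s).getD a [])
          (by rw [List.getD_eq_getElem _ _ (by rw [hld]; exact a.2)]; exact List.getElem_mem _)
          (off + b) (by omega)
        rwa [hdrop, hR (s + a) (by omega) (off + b) (by omega)] at hz
      -- assemble through `fromBlocks`
      set M : Matrix (Fin (s + ss.sum)) (Fin (s + ss.sum)) ℤ :=
        Matrix.of fun a b : Fin (s + ss.sum) => ((N (off + a) (off + b) : ℕ) : ℤ) with hMdef
      have hM' : M.submatrix finSumFinEquiv finSumFinEquiv =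
          Matrix.fromBlocks A ((M.submatrix finSumFinEquiv finSumFinEquiv).toBlocks₁₂) 0
            (Matrix.of fun a b : Fin ss.sum => ((N (off + s + a) (off + s + b) : ℕ) : ℤ)) := by
        ext (a | a) (b | b)
        · simp [hMdef, hAdef]
        · simp [Matrix.toBlocks₁₂]
        · simp [hMdef, hC]
        · simp [hMdef, Nat.add_assoc]
      rw [← Matrix.det_submatrix_equiv_self finSumFinEquiv M, hM', Matrix.det_fromBlocks_zero₂₁]
      exact mul_ne_zero hA hD

/-- **Block-triangular certificate ⇒ `det G_i ≠ 0`.** -/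
theorem det_peelMatrix_ne_zero_of_btfCert {p : ℕ} (hp : 1 < p) (i : ℕ) (d : List ℕ × List ℕ × List ℕ)
    (h : btfCert p i d = true) : (peelMatrix i).det ≠ 0 := by
  obtain ⟨σ, τ, sizes⟩ := d
  simp only [btfCert, permCheck, Bool.and_eq_true, decide_eq_true_eq, List.all_eq_true] at h
  obtain ⟨⟨⟨⟨⟨hσl, hσb⟩, hσn⟩, ⟨⟨hτl, hτb⟩, hτn⟩⟩, hsum⟩, hchk⟩ := h
  -- the two permutations as equivalences of `Fin i`
  have hσi : ∀ a : Fin i, σ.getD a 0 < i := fun a => by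
    rw [List.getD_eq_getElem _ _ (by omega)]; exact hσb _ (List.getElem_mem _)
  have hτi : ∀ a : Fin i, τ.getD a 0 < i := fun a => by
    rw [List.getD_eq_getElem _ _ (by omega)]; exact hτb _ (List.getElem_mem _)
  let σf : Fin i → Fin i := fun a => ⟨σ.getD a 0, hσi a⟩
  let τf : Fin i → Fin i := fun a => ⟨τ.getD a 0, hτi a⟩
  have hσinj : Function.Injective σf := by
    intro a b hab
    have hab' : σ.getD a 0 = σ.getD b 0 := congrArg Fin.val hab
    rw [List.getD_eq_getElem _ _ (by omega), List.getD_eq_getElem _ _ (by omega), hσn.getElem_inj_iff] at hab'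
    exact Fin.ext hab'
  have hτinj : Function.Injective τf := by
    intro a b hab
    have hab' : τ.getD a 0 = τ.getD b 0 := congrArg Fin.val hab
    rw [List.getD_eq_getElem _ _ (by omega), List.getD_eq_getElem _ _ (by omega), hτn.getElem_inj_iff] at hab'
    exact Fin.ext hab'
  let σe : Fin i ≃ Fin i := Equiv.ofBijective σf (Finite.injective_iff_bijective.mp hσinj)
  let τe : Fin i ≃ Fin i := Equiv.ofBijective τf (Finite.injective_iff_bijective.mp hτinj)
  -- the permuted matrix, read through `permRows`
  have hmain := det_ne_zero_of_checkBlocks hp (fun a b => gEntry i (σ.getD a 0) (τ.getD b 0)) i sizes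
    (permRows i σ τ) 0 i hsum (by omega) (by simp [permRows, hσl]) (fun a ha c hc => by
      rw [permRows_getD i σ τ a c (by omega) (by omega), Nat.zero_add]) hchk
  have hsub : (Matrix.of fun a b : Fin i => ((gEntry i (σ.getD (0 + a) 0) (τ.getD (0 + b) 0) : ℕ) : ℤ)) =
      (peelMatrix i).submatrix σe τe := by
    ext a b
    rw [Matrix.of_apply, Matrix.submatrix_apply, peelMatrix_eq_gEntry, Nat.zero_add, Nat.zero_add]
    rfl
  rw [hsub] at hmain
  intro hdet
  apply hmain
  have habs := Matrix.abs_det_submatrix_equiv_equiv σe τe (peelMatrix i)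
  rw [hdet, abs_zero, abs_eq_zero] at habs
  exact habs

/-- **A passing table gives `det G_i ≠ 0` on its range.** -/
theorem det_peelMatrix_ne_zero_of_btfTableCheck {p a len : ℕ} (hp : 1 < p)
    {T : List (ℕ × List ℕ × List ℕ × List ℕ)} (h : btfTableCheck p a len T = true)
    (i : ℕ) (hai : a ≤ i) (hia : i < a + len) : (peelMatrix i).det ≠ 0 := by
  rw [btfTableCheck, Bool.and_eq_true, decide_eq_true_eq, List.all_eq_true] at h
  obtain ⟨hcov, hall⟩ := h
  have hi : i ∈ T.map Prod.fst := by rw [hcov]; exact List.mem_range'_1.mpr ⟨hai, hia⟩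
  obtain ⟨e, he, rfl⟩ := List.mem_map.mp hi
  exact det_peelMatrix_ne_zero_of_btfCert hp e.1 e.2 (hall e he)

/-! ## 3. The registered stub's statement (by-name credit recipe) -/

/-- VERBATIM copy of `Stmt.stub_window` of the registered skeleton `Cruxes/ChowBenchmarkPairs/Lines/moore_peel.lean`
(the Cruxes module is not an importable build target, so the statement is restated under the Theorems namespace; the
registered stub signature is the name `Stmt.stub_window`): the certified window `h ≤ 182` of MC-bench(s = 2). -/
def Stmt.stub_window : Prop := ∀ h : ℕ, h ≤ 182 → MCBenchPairsAt h

end Summit.ValiantsHypothesis.ValiantsHypothesis.Theorems.BarrierLever.MoorePeel
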